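import Literature.Topology.FourManifolds.HomotopySpheresSumProofs
import Literature.AlgebraicTopology.Homotopy.WhiteheadTheorem
import Literature.AlgebraicTopology.SingularHomology.MayerVietorisExactness
import Literature.AlgebraicTopology.SingularHomology.CollapseMap
import HarnessLib

/-!
# Sums of homotopy spheres are homology spheres (Mayer–Vietoris), hence homotopy spheres (Whitehead)

Topic `Literature/Topology/FourManifolds`, second proofs file of `HomotopySpheresSum.lean` for the
tree fact `Literature.Topology.FourManifolds.HomotopySphere.nonempty_homotopyEquiv_sphere_of_isConnectedSum` — Kervaire–Milnor,
*Groups of homotopy spheres I* (1963), §2, p. 505: "It is clear that the sum of two homotopy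
`n`-spheres is a homotopy `n`-sphere". This file formalises the **printed** architecture of that
remark (Kosinski, *Differential Manifolds* (1993), Ch. VI §2, Prop. 2.1: "The connected sum of
two manifolds is a homotopy sphere if and only if both are homotopy spheres", proof: the
Mayer–Vietoris sequence of the cover of `M₁ # M₂` by the punctured summands gives
`Hᵢ(M₁ # M₂) = Hᵢ(M₁) ⊕ Hᵢ(M₂)`, `0 < i < m`; van Kampen for `m ≥ 3`; then Whitehead), as a
complement to `HomotopySpheresSumProofs.lean` (which went through the contractibility of
punctured homotopy spheres and the Whitehead–Hurewicz recognition fact for open manifolds):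

* §1–§2, PROVED, general: a four lemma with a zero corner in `ModuleCat`
  (`isIso_of_mono_of_exact_ladder`) and the **Mayer–Vietoris comparison lemma**
  `isIso_singularHomology_map_succ_of_mayerVietoris`: a map of open-interior covers
  `(X; U, V) → (Y; U', V')` with `Hₖ₊₁` of the four pieces zero, `(f|U ∩ V)_*` an isomorphism on
  `Hₖ` and `(f|U)_* ⊕ (f|V)_*` injective on `Hₖ` is an isomorphism on `Hₖ₊₁` (Hatcher 2002, §2.2
  p. 150, naturality of Mayer–Vietoris — tree theorems `mayerVietoris.exact₂_holds`,
  `exact₃_holds`, `δ_naturality_holds`, excision `isIso_map_of_interior_union_interior_holds`).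
* §3, PROVED, for the abstract suspension-like covers of `SuspensionLikeCover.lean`: the
  comparison map `toModel : P → Q` is closed, restricts to a homeomorphism of the open cylinder
  onto the doubly punctured model, and — when the two open pieces `P ∖ bodyᵢ` are path connected
  and acyclic and the pole complements of `Q` are contractible — induces isomorphisms on all
  `Hₖ(-; M)` (`SuspensionLikeCover.isIso_singularHomology_map_toModel`).
* §4, PROVED: **the connected sum `P` of two homotopy `n`-spheres, `n ≥ 2`, is an integral
  homology sphere** — the pinch map `P → Sⁿ` is an `H_*(-; ℤ)`-isomorphism
  (`ConnectedSumNeck.isIso_singularHomology_map_toModel`,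
  `HomotopySphere.exists_isIso_singularHomology_map_of_isConnectedSum`; inputs: the punctured
  summands are path connected, `PuncturedHomotopySphere.lean`, and acyclic,
  `PuncturedHomotopySphereHomology.lean`); and, for `n ≥ 3`, **a homotopy sphere given
  Whitehead's theorem** (`HomotopySphere.nonempty_homotopyEquiv_sphere_of_isConnectedSum_of_whitehead`):
  `P` is simply connected (tree theorem `HomotopySphere.simplyConnectedSpace_of_isConnectedSum`,
  van Kampen) and the pinch map is a homotopy equivalence by the tree theorem
  `exists_homotopyEquiv_of_isIso_map_of_closedManifold` (`WhiteheadTheorem.lean`), i.e. by the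
  two named facts `Literature.AlgebraicTopology.Homotopy.whitehead_exists_homotopyEquiv` (Hatcher 2002, Cor. 4.33) and
  `Literature.AlgebraicTopology.Homotopy.exists_cwComplex_homotopyEquiv_of_compactSpace` (Hatcher 2002, Cor. A.12), shared with
  the homotopy-4-sphere files (spc4.S10).
* Assembled: `HomotopySphere.nonempty_homotopyEquiv_sphere_of_isConnectedSum_of_whitehead_of_spc`
  and `…_of_whitehead_of_facts`: Kervaire–Milnor's statement in all dimensions from Hatcher's
  Cor. 4.33 + Cor. A.12 (`n ≥ 3`) and the smooth Poincaré conjecture in dimensions `1, 2`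
  (`n = 1, 2`, tree fact `Literature.Topology.FourManifolds.nonemptyDiffeomorphSphere_of_mem`, spc4.S32, through
  `HomotopySpheresSumProofs.lean`); dimension `0` and everything else proved. No `_holds` is
  claimed: Whitehead's theorem, the CW homotopy type of compact manifolds and the classification
  of curves and surfaces are not proved in Mathlib or `Literature/` at this pin.

## Design notes

* Homology is `Literature.singularHomology R M` (Mathlib's singular homology functor); §4 is over `ℤ`
  (`PuncturedHomotopySphereHomology.lean` is) and in universe `0` (`HomotopySphere.carrier`,
  `Sⁿ : Type`; `singularHomology.map` relates spaces of one universe), so the Whitehead facts are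
  consumed at `.{0}`.
* The Mayer–Vietoris covers are `{P ∖ body₁, P ∖ body₀}` and `{Sⁿ ∖ south, Sⁿ ∖ north}` in this
  order (`toModel` maps `body₀ ↦ north`, `body₁ ↦ south`); their intersections are the open
  cylinder `e(Sⁿ⁻¹ × (0, 1))` and `Sⁿ ∖ {N, S}`, identified by `toModel` (a continuous closed
  bijection, `isIso_singularHomology_map_restrict_toModel`).
* No declaration in this file uses `sorry`; the file adds no named fact.

## References

* M. Kervaire, J. Milnor, *Groups of homotopy spheres I*, Ann. of Math. 77 (1963), §2, p. 505.
  [KervaireMilnorAnnals1963]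
* A. Kosinski, *Differential Manifolds*, Academic Press (1993), Ch. VI §2, Prop. 2.1 (and §1,
  remark before Cor. 1.4). [Kosinski1993]
* A. Hatcher, *Algebraic Topology*, CUP (2002), §2.1 p. 129 (five lemma), §2.2 pp. 149–150
  (Mayer–Vietoris and its naturality), Cor. 4.33, Cor. A.12. [HatcherAT2002]
-/

noncomputable section

open scoped Manifold ContDiff Topology ContinuousMap unitInterval
open CategoryTheory Limits Set Function Metric Module Topology

universe u v w

namespace Literature.Topology.FourManifolds

/-- Local notation: `𝔼 n` is the model Euclidean space `EuclideanSpace ℝ (Fin n)`. -/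
local notation "𝔼 " n:arg => EuclideanSpace ℝ (Fin n)

/-- Local notation: `𝕊 n` is the unit sphere in `EuclideanSpace ℝ (Fin (n + 1))`. -/
local notation "𝕊 " n:arg => (Metric.sphere (0 : EuclideanSpace ℝ (Fin (n + 1))) 1)

attribute [local instance] fact_finrank_euclideanSpace_succ

/-! ### §1 Algebra: a four lemma with a zero corner -/

section Ladder

variable {A : Type v} [Ring A] {B C D B' C' D' : ModuleCat.{w} A}

/-- **A four lemma with a zero corner** (Hatcher, *Algebraic Topology* (2002), §2.1, the five
lemma, p. 129, in the special case used for Mayer–Vietoris ladders whose `Hₖ(U) ⊕ Hₖ(V)` terms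
vanish). Given a commutative ladder of `A`-modules
`B →δ C →φ D` over `B' →δ' C' →φ' D'` with vertical maps `f, g, h`, in which `δ` and `δ'` are
injective, `im δ = ker φ`, `δ' ≫ φ' = 0`, `g` is an isomorphism and `h` is injective, the map `f`
is an isomorphism. (Diagram chase.) [cite: HatcherAT2002, §2.1 p. 129 (five lemma)] -/
theorem isIso_of_mono_of_exact_ladder {δ : B ⟶ C} {φ : C ⟶ D} {δ' : B' ⟶ C'} {φ' : C' ⟶ D'}
    (f : B ⟶ B') (g : C ⟶ C') (h : D ⟶ D') [Mono δ] [Mono δ'] (w : δ ≫ φ = 0)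
    (ex : (ShortComplex.mk δ φ w).Exact) (w' : δ' ≫ φ' = 0) [IsIso g] [Mono h]
    (sq₁ : δ ≫ g = f ≫ δ') (sq₂ : φ ≫ h = g ≫ φ') : IsIso f := by
  have hδ : Injective δ := (ModuleCat.mono_iff_injective δ).mp inferInstance
  have hδ' : Injective δ' := (ModuleCat.mono_iff_injective δ').mp inferInstance
  have hh : Injective h := (ModuleCat.mono_iff_injective h).mp inferInstance
  have hg : Injective g := (ModuleCat.mono_iff_injective g).mp inferInstance
  have hmono : Mono f := by
    rw [ModuleCat.mono_iff_injective]
    intro x y hxy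
    apply hδ
    apply hg
    rw [← ModuleCat.comp_apply, ← ModuleCat.comp_apply, sq₁, ModuleCat.comp_apply,
      ModuleCat.comp_apply, hxy]
  have hepi : Epi f := by
    rw [ModuleCat.epi_iff_surjective]
    intro y
    -- `c = g⁻¹ (δ' y)` lies in `ker φ = im δ`
    have hgc : g (inv g (δ' y)) = δ' y := by
      rw [← ModuleCat.comp_apply, IsIso.inv_hom_id, ModuleCat.id_apply]
    have hφc : φ (inv g (δ' y)) = 0 := by
      apply hh
      rw [map_zero, ← ModuleCat.comp_apply, sq₂, ModuleCat.comp_apply, hgc,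
        ← ModuleCat.comp_apply, w']
      rfl
    obtain ⟨x, hx⟩ := (ShortComplex.moduleCat_exact_iff _).mp ex _ hφc
    change δ x = inv g (δ' y) at hx
    refine ⟨x, hδ' ?_⟩
    rw [← ModuleCat.comp_apply, ← sq₁, ModuleCat.comp_apply, hx, hgc]
  exact isIso_of_mono_of_epi f

end Ladder

/-! ### §2 The Mayer–Vietoris comparison lemma -/

section Comparison

variable (R : Type v) [CommRing R] (M : Type v) [AddCommGroup M] [Module R M]
variable {X Y : Type u} [TopologicalSpace X] [TopologicalSpace Y]

/-- **Mayer–Vietoris comparison** (Hatcher, *Algebraic Topology* (2002), §2.2 p. 150, naturality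
of the Mayer–Vietoris sequence, with the five lemma p. 129). Let `f : X → Y` map the cover
`X = int U ∪ int V` into the cover `Y = int U' ∪ int V'` (`f(U) ⊆ U'`, `f(V) ⊆ V'`), and let
`k ≥ 0`. If `Hₖ₊₁(U) = Hₖ₊₁(V) = Hₖ₊₁(U') = Hₖ₊₁(V') = 0`, `(f|U ∩ V)_* : Hₖ(U ∩ V) → Hₖ(U' ∩ V')`
is an isomorphism and `(f|U)_* ⊕ (f|V)_* : Hₖ(U) ⊕ Hₖ(V) → Hₖ(U') ⊕ Hₖ(V')` is injective, then
`f_* : Hₖ₊₁(X) → Hₖ₊₁(Y)` is an isomorphism: compare the exact rows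
`0 → Hₖ₊₁(X) →δ Hₖ(U ∩ V) →φ Hₖ(U) ⊕ Hₖ(V)` (tree theorems `mayerVietoris.exact₂_holds`,
`exact₃_holds`, `δ_naturality_holds`, excision `isIso_map_of_interior_union_interior_holds`).
[cite: HatcherAT2002, §2.2 p. 150] -/
theorem isIso_singularHomology_map_succ_of_mayerVietoris (f : C(X, Y)) {U V : Set X}
    {U' V' : Set Y} (hU : MapsTo f U U') (hV : MapsTo f V V')
    (hc : interior U ∪ interior V = univ) (hc' : interior U' ∪ interior V' = univ) (k : ℕ)
    (hUz : IsZero (Literature.AlgebraicTopology.SingularHomology.singularHomology R M U (k + 1))) (hVz : IsZero (Literature.AlgebraicTopology.SingularHomology.singularHomology R M V (k + 1)))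
    (hU'z : IsZero (Literature.AlgebraicTopology.SingularHomology.singularHomology R M U' (k + 1)))
    (hV'z : IsZero (Literature.AlgebraicTopology.SingularHomology.singularHomology R M V' (k + 1)))
    [IsIso (Literature.AlgebraicTopology.SingularHomology.singularHomology.map R M (Literature.AlgebraicTopology.SingularHomology.subsetRestrict f (hU.inter_inter hV)) k)]
    [Mono (biprod.map (Literature.AlgebraicTopology.SingularHomology.singularHomology.map R M (Literature.AlgebraicTopology.SingularHomology.subsetRestrict f hU) k)
      (Literature.AlgebraicTopology.SingularHomology.singularHomology.map R M (Literature.AlgebraicTopology.SingularHomology.subsetRestrict f hV) k))] :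
    IsIso (Literature.AlgebraicTopology.SingularHomology.singularHomology.map R M f (k + 1)) := by
  have hexc := Literature.AlgebraicTopology.SingularHomology.relativeSingularHomology.isIso_map_of_interior_union_interior_holds R M X
  have hexc' := Literature.AlgebraicTopology.SingularHomology.relativeSingularHomology.isIso_map_of_interior_union_interior_holds R M Y
  -- `ψ = 0` on both rows, so both connecting maps are injective
  have hψ : Literature.AlgebraicTopology.SingularHomology.mayerVietoris.ψ R M U V (k + 1) = 0 := by
    apply biprod.hom_ext'
    · exact hUz.eq_of_src _ _
    · exact hVz.eq_of_src _ _
  have hψ' : Literature.AlgebraicTopology.SingularHomology.mayerVietoris.ψ R M U' V' (k + 1) = 0 := by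
    apply biprod.hom_ext'
    · exact hU'z.eq_of_src _ _
    · exact hV'z.eq_of_src _ _
  haveI : Mono (Literature.AlgebraicTopology.SingularHomology.mayerVietoris.δ R M U V hexc hc k) :=
    (Literature.AlgebraicTopology.SingularHomology.mayerVietoris.exact₂_holds R M U V hexc hc k).mono_g hψ
  haveI : Mono (Literature.AlgebraicTopology.SingularHomology.mayerVietoris.δ R M U' V' hexc' hc' k) :=
    (Literature.AlgebraicTopology.SingularHomology.mayerVietoris.exact₂_holds R M U' V' hexc' hc' k).mono_g hψ'
  refine isIso_of_mono_of_exact_ladder (Literature.AlgebraicTopology.SingularHomology.singularHomology.map R M f (k + 1))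
    (Literature.AlgebraicTopology.SingularHomology.singularHomology.map R M (Literature.AlgebraicTopology.SingularHomology.subsetRestrict f (hU.inter_inter hV)) k)
    (biprod.map (Literature.AlgebraicTopology.SingularHomology.singularHomology.map R M (Literature.AlgebraicTopology.SingularHomology.subsetRestrict f hU) k)
      (Literature.AlgebraicTopology.SingularHomology.singularHomology.map R M (Literature.AlgebraicTopology.SingularHomology.subsetRestrict f hV) k))
    (Literature.AlgebraicTopology.SingularHomology.mayerVietoris.δ_comp_φ R M U V hexc hc k) (Literature.AlgebraicTopology.SingularHomology.mayerVietoris.exact₃_holds R M U V hexc hc k)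
    (Literature.AlgebraicTopology.SingularHomology.mayerVietoris.δ_comp_φ R M U' V' hexc' hc' k)
    (Literature.AlgebraicTopology.SingularHomology.mayerVietoris.δ_naturality_holds R M hexc hexc' f hU hV hc hc' k) ?_
  -- the square `φ ≫ ((f|U)_* ⊕ (f|V)_*) = (f|U ∩ V)_* ≫ φ'`: two inclusions commute with `f`
  apply biprod.hom_ext
  · simp only [Literature.AlgebraicTopology.SingularHomology.mayerVietoris.φ, Category.assoc, biprod.map_fst, biprod.lift_fst_assoc,
      biprod.lift_fst]
    rw [← Literature.AlgebraicTopology.SingularHomology.singularHomology.map_comp, ← Literature.AlgebraicTopology.SingularHomology.singularHomology.map_comp]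
    rfl
  · simp only [Literature.AlgebraicTopology.SingularHomology.mayerVietoris.φ, Category.assoc, biprod.map_snd, biprod.lift_snd_assoc,
      biprod.lift_snd, Preadditive.neg_comp, Preadditive.comp_neg, neg_inj]
    rw [← Literature.AlgebraicTopology.SingularHomology.singularHomology.map_comp, ← Literature.AlgebraicTopology.SingularHomology.singularHomology.map_comp]
    rfl

end Comparison

/-! ### §3 Suspension-like covers: the comparison map is a homology isomorphism -/

section SuspensionModel
open Literature.AlgebraicTopology.Homotopy (SuspensionModel)
open Literature.AlgebraicTopology.Homotopy.SuspensionModel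

variable {X : Type u} {Q : Type w} [TopologicalSpace X] [TopologicalSpace Q]
  (m : SuspensionModel X Q)

/-- The two pole complements cover the model. [folklore] -/
theorem _root_.Literature.AlgebraicTopology.Homotopy.SuspensionModel.compl_south_union_compl_north : ({m.south}ᶜ : Set Q) ∪ {m.north}ᶜ = univ :=
  eq_univ_of_forall fun q => by
    by_cases h : q = m.south
    · subst h
      exact Or.inr m.north_ne_south.symm
    · exact Or.inl h

/-- The two (open) pole complements cover the model. [folklore] -/
theorem _root_.Literature.AlgebraicTopology.Homotopy.SuspensionModel.interior_compl_south_union [T1Space Q] :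
    interior ({m.south}ᶜ : Set Q) ∪ interior {m.north}ᶜ = univ := by
  rw [isOpen_compl_singleton.interior_eq, isOpen_compl_singleton.interior_eq]
  exact m.compl_south_union_compl_north

end SuspensionModel

section SuspensionLikeCover
open Literature.AlgebraicTopology.Homotopy (SuspensionLikeCover)
open Literature.AlgebraicTopology.Homotopy.SuspensionLikeCover

variable {X : Type u} {P Q : Type w} [TopologicalSpace X] [TopologicalSpace P]
  [TopologicalSpace Q] (c : SuspensionLikeCover X P) (m : Literature.AlgebraicTopology.Homotopy.SuspensionModel X Q)

/-- A point off both bodies is an interior point `e (x, s)`, `0 < s < 1`, of the cylinder.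
[folklore] -/
theorem _root_.Literature.AlgebraicTopology.Homotopy.SuspensionLikeCover.exists_eq_neck_of_not_mem {p : P} (h₀ : p ∉ c.body₀) (h₁ : p ∉ c.body₁) :
    ∃ (x : X) (s : I), s ≠ 0 ∧ s ≠ 1 ∧ c.neck (x, s) = p := by
  rcases c.cover p with h | h | ⟨⟨x, s⟩, rfl⟩
  · exact absurd h h₀
  · exact absurd h h₁
  · refine ⟨x, s, ?_, ?_, rfl⟩
    · rintro rfl
      exact h₀ (c.neck_zero_mem x)
    · rintro rfl
      exact h₁ (c.neck_one_mem x)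

/-- The two body complements cover `P` (the bodies are disjoint). [folklore] -/
theorem _root_.Literature.AlgebraicTopology.Homotopy.SuspensionLikeCover.compl_body₁_union_compl_body₀ : (c.body₁)ᶜ ∪ (c.body₀)ᶜ = univ :=
  eq_univ_of_forall fun p => by
    by_cases h : p ∈ c.body₁
    · exact Or.inr (c.not_mem_body₀ h)
    · exact Or.inl h

/-- The two (open) body complements cover `P`. [folklore] -/
theorem _root_.Literature.AlgebraicTopology.Homotopy.SuspensionLikeCover.interior_compl_body₁_union : interior (c.body₁)ᶜ ∪ interior (c.body₀)ᶜ = univ := by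
  rw [c.isClosed_body₁.isOpen_compl.interior_eq, c.isClosed_body₀.isOpen_compl.interior_eq]
  exact c.compl_body₁_union_compl_body₀

section Compact

variable [CompactSpace X] [T2Space P]

/-- The comparison map sends the complement of `body₁` into the complement of the south pole.
[folklore] -/
theorem _root_.Literature.AlgebraicTopology.Homotopy.SuspensionLikeCover.toModel_ne_south {p : P} (h₁ : p ∉ c.body₁) : c.toModel m p ≠ m.south := by
  by_cases h₀ : p ∈ c.body₀
  · rw [toModel_apply, c.toModelFun_of_mem_body₀ m h₀]
    exact m.north_ne_south
  · obtain ⟨x, s, -, hs1, rfl⟩ := c.exists_eq_neck_of_not_mem h₀ h₁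
    rw [toModel_apply, c.toModelFun_neck m]
    exact fun h => hs1 (m.eq_one_of_map_eq_south h)

/-- The comparison map sends the complement of `body₀` into the complement of the north pole.
[folklore] -/
theorem _root_.Literature.AlgebraicTopology.Homotopy.SuspensionLikeCover.toModel_ne_north {p : P} (h₀ : p ∉ c.body₀) : c.toModel m p ≠ m.north := by
  by_cases h₁ : p ∈ c.body₁
  · rw [toModel_apply, c.toModelFun_of_mem_body₁ m h₁]
    exact m.north_ne_south.symm
  · obtain ⟨x, s, hs0, -, rfl⟩ := c.exists_eq_neck_of_not_mem h₀ h₁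
    rw [toModel_apply, c.toModelFun_neck m]
    exact fun h => hs0 (m.eq_zero_of_map_eq_north h)

/-- `toModel (P ∖ body₁) ⊆ Q ∖ {south}`. [folklore] -/
theorem _root_.Literature.AlgebraicTopology.Homotopy.SuspensionLikeCover.mapsTo_toModel_compl_body₁ : MapsTo (c.toModel m) (c.body₁)ᶜ ({m.south}ᶜ : Set Q) :=
  fun _ hp => c.toModel_ne_south m hp

/-- `toModel (P ∖ body₀) ⊆ Q ∖ {north}`. [folklore] -/
theorem _root_.Literature.AlgebraicTopology.Homotopy.SuspensionLikeCover.mapsTo_toModel_compl_body₀ : MapsTo (c.toModel m) (c.body₀)ᶜ ({m.north}ᶜ : Set Q) :=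
  fun _ hp => c.toModel_ne_north m hp

/-- The preimage of the doubly punctured model `Q ∖ {south, north}` is the open cylinder
`P ∖ (body₁ ∪ body₀)`. [folklore] -/
theorem _root_.Literature.AlgebraicTopology.Homotopy.SuspensionLikeCover.preimage_toModel_compl_inter_compl :
    c.toModel m ⁻¹' (({m.south}ᶜ : Set Q) ∩ {m.north}ᶜ) = (c.body₁)ᶜ ∩ (c.body₀)ᶜ := by
  ext p
  simp only [mem_preimage, mem_inter_iff, mem_compl_iff, mem_singleton_iff]
  constructor
  · rintro ⟨hS, hN⟩
    exact ⟨fun h => hS (c.toModelFun_of_mem_body₁ m h), fun h => hN (c.toModelFun_of_mem_body₀ m h)⟩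
  · rintro ⟨h₁, h₀⟩
    exact ⟨c.toModel_ne_south m h₁, c.toModel_ne_north m h₀⟩

/-- The image of a set under the comparison map, piece by piece. [folklore] -/
theorem _root_.Literature.AlgebraicTopology.Homotopy.SuspensionLikeCover.image_toModel_eq (C : Set P) :
    c.toModel m '' C =
      c.toModel m '' (C ∩ c.body₀) ∪ c.toModel m '' (C ∩ c.body₁) ∪ m.map '' (c.neck ⁻¹' C) := by
  apply Subset.antisymm
  · rintro _ ⟨p, hp, rfl⟩
    rcases c.cover p with h | h | ⟨z, rfl⟩
    · exact Or.inl (Or.inl ⟨p, ⟨hp, h⟩, rfl⟩)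
    · exact Or.inl (Or.inr ⟨p, ⟨hp, h⟩, rfl⟩)
    · exact Or.inr ⟨z, hp, (c.toModelFun_neck m z).symm⟩
  · rintro q ((⟨p, hp, rfl⟩ | ⟨p, hp, rfl⟩) | ⟨z, hz, rfl⟩)
    · exact ⟨p, hp.1, rfl⟩
    · exact ⟨p, hp.1, rfl⟩
    · exact ⟨c.neck z, hz, c.toModelFun_neck m z⟩

/-- **The comparison map is closed** (`X` compact, `Q` Hausdorff): the image of a closed set is
the union of at most two poles and of the compact set `σ (e⁻¹ C)`. [folklore] -/
theorem _root_.Literature.AlgebraicTopology.Homotopy.SuspensionLikeCover.isClosedMap_toModel [T2Space Q] : IsClosedMap (c.toModel m) := by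
  intro C hC
  rw [c.image_toModel_eq m C]
  refine (IsClosed.union ?_ ?_).union ?_
  · apply Set.Subsingleton.isClosed
    rintro _ ⟨p, hp, rfl⟩ _ ⟨p', hp', rfl⟩
    rw [toModel_apply, toModel_apply, c.toModelFun_of_mem_body₀ m hp.2,
      c.toModelFun_of_mem_body₀ m hp'.2]
  · apply Set.Subsingleton.isClosed
    rintro _ ⟨p, hp, rfl⟩ _ ⟨p', hp', rfl⟩
    rw [toModel_apply, toModel_apply, c.toModelFun_of_mem_body₁ m hp.2,
      c.toModelFun_of_mem_body₁ m hp'.2]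
  · exact ((hC.preimage c.continuous_neck).isCompact.image m.continuous_map).isClosed

variable (R : Type v) [CommRing R] (M : Type v) [AddCommGroup M] [Module R M]

/-- **The comparison map restricts to a homeomorphism of the open cylinder onto the doubly
punctured model**, `P ∖ (body₀ ∪ body₁) ≅ Q ∖ {north, south}` (a continuous closed bijection),
and so induces isomorphisms on the homology of these pieces. [folklore] -/
theorem _root_.Literature.AlgebraicTopology.Homotopy.SuspensionLikeCover.isIso_singularHomology_map_restrict_toModel [T2Space Q] (k : ℕ) :
    IsIso (Literature.AlgebraicTopology.SingularHomology.singularHomology.map R M (Literature.AlgebraicTopology.SingularHomology.subsetRestrict (c.toModel m)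
      ((c.mapsTo_toModel_compl_body₁ m).inter_inter (c.mapsTo_toModel_compl_body₀ m))) k) := by
  set g := Literature.AlgebraicTopology.SingularHomology.subsetRestrict (c.toModel m)
      ((c.mapsTo_toModel_compl_body₁ m).inter_inter (c.mapsTo_toModel_compl_body₀ m)) with hg
  -- injective: two interior cylinder points with the same suspension coordinates agree
  have hinj : Injective g := by
    rintro ⟨p, hp⟩ ⟨p', hp'⟩ h
    obtain ⟨x, s, hs0, hs1, rfl⟩ := c.exists_eq_neck_of_not_mem hp.2 hp.1
    obtain ⟨x', s', -, -, rfl⟩ := c.exists_eq_neck_of_not_mem hp'.2 hp'.1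
    have h' : m.map (x, s) = m.map (x', s') := by
      have e := congrArg Subtype.val h
      change c.toModel m (c.neck (x, s)) = c.toModel m (c.neck (x', s')) at e
      rwa [toModel_apply, toModel_apply, c.toModelFun_neck m, c.toModelFun_neck m] at e
    obtain ⟨rfl, hx⟩ := m.eq_of_map_eq h'
    rcases hx with rfl | h0 | h1
    · rfl
    · exact absurd h0 hs0
    · exact absurd h1 hs1
  -- surjective: a point off the poles is `σ (x, s)` with `0 < s < 1`
  have hsurj : Surjective g := by
    rintro ⟨q, hqS, hqN⟩
    rcases m.cover q with rfl | rfl | ⟨⟨x, s⟩, rfl⟩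
    · exact absurd rfl hqN
    · exact absurd rfl hqS
    · have hs0 : s ≠ 0 := by
        rintro rfl
        exact hqN (m.map_zero x)
      have hs1 : s ≠ 1 := by
        rintro rfl
        exact hqS (m.map_one x)
      refine ⟨⟨c.neck (x, s), fun h => hs1 (c.eq_one_of_neck_mem h),
        fun h => hs0 (c.eq_zero_of_neck_mem h)⟩, Subtype.ext ?_⟩
      change c.toModel m (c.neck (x, s)) = m.map (x, s)
      rw [toModel_apply, c.toModelFun_neck]
  -- closed: the restriction of the closed map `toModel` to the preimage of `Q ∖ {north, south}`
  have hclosed : IsClosedMap g := by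
    intro C hC
    obtain ⟨C', hC', rfl⟩ := isClosed_induced_iff.mp hC
    have himage : g '' (Subtype.val ⁻¹' C') = Subtype.val ⁻¹' (c.toModel m '' C') := by
      apply Subset.antisymm
      · rintro _ ⟨p, hp, rfl⟩
        exact ⟨p.1, hp, rfl⟩
      · rintro ⟨q, hq⟩ ⟨p₁, hp₁, hpq⟩
        have hpW : p₁ ∈ (c.body₁)ᶜ ∩ (c.body₀)ᶜ := by
          rw [← c.preimage_toModel_compl_inter_compl m, mem_preimage, hpq]
          exact hq
        exact ⟨⟨p₁, hpW⟩, hp₁, Subtype.ext hpq⟩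
    rw [himage]
    exact (c.isClosedMap_toModel m C' hC').preimage continuous_subtype_val
  have hemb : IsClosedEmbedding g :=
    .of_continuous_injective_isClosedMap g.continuous hinj hclosed
  let e := (Equiv.ofBijective g ⟨hinj, hsurj⟩).toHomeomorphOfIsInducing hemb.isInducing
  have he : (e.toHomotopyEquiv.toFun : C(_, _)) = g := by
    ext x
    rfl
  have : Literature.AlgebraicTopology.SingularHomology.singularHomology.map R M g k =
      (Literature.AlgebraicTopology.SingularHomology.singularHomology.isoOfHomotopyEquiv R M e.toHomotopyEquiv k).hom := by
    rw [Literature.AlgebraicTopology.SingularHomology.singularHomology.isoOfHomotopyEquiv_hom, he]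
  rw [this]
  infer_instance

/-- **The comparison map of a suspension-like cover with acyclic pieces is a homology
isomorphism** (the Mayer–Vietoris computation in Kosinski, *Differential Manifolds* (1993),
VI §2, proof of Prop. 2.1, made relative to `Q`). Let `P = body₀ ∪ e(X × [0,1]) ∪ body₁` be a
suspension-like cover over a nonempty compact `X` and `σ : X × [0,1] → Q` a suspension model
with contractible pole complements (e.g. `Q = Sⁿ`). If the open pieces `P ∖ body₁`, `P ∖ body₀`
are path connected with `H̃_*(-; M) = 0`, then `toModel : P → Q` (bodies to poles, `e (x, s)` to
`σ (x, s)`) induces isomorphisms `Hₖ(P; M) ≅ Hₖ(Q; M)` for all `k`: in degree `0` both spaces are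
path connected; in degree `k + 1` apply the Mayer–Vietoris comparison lemma to the covers
`{P ∖ body₁, P ∖ body₀}` and `{Q ∖ south, Q ∖ north}`, whose intersections `toModel` identifies.
[cite: Kosinski1993, Ch. VI §2 Prop. 2.1] [cite: HatcherAT2002, §2.2 p. 150] -/
theorem _root_.Literature.AlgebraicTopology.Homotopy.SuspensionLikeCover.isIso_singularHomology_map_toModel [Nonempty X] [T2Space Q]
    (h₁ : IsPathConnected (c.body₁)ᶜ) (h₀ : IsPathConnected (c.body₀)ᶜ)
    (hz₁ : ∀ k, 1 ≤ k → IsZero (Literature.AlgebraicTopology.SingularHomology.singularHomology R M ↥(c.body₁)ᶜ k))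
    (hz₀ : ∀ k, 1 ≤ k → IsZero (Literature.AlgebraicTopology.SingularHomology.singularHomology R M ↥(c.body₀)ᶜ k))
    (hS : ContractibleSpace ↥(({m.south}ᶜ : Set Q)))
    (hN : ContractibleSpace ↥(({m.north}ᶜ : Set Q))) (k : ℕ) :
    IsIso (Literature.AlgebraicTopology.SingularHomology.singularHomology.map R M (c.toModel m) k) := by
  -- a point on the equator of the cylinder
  obtain ⟨x₀⟩ := ‹Nonempty X›
  let s₀ : I := ⟨2⁻¹, by norm_num, by norm_num⟩
  have hs₀0 : s₀ ≠ 0 := fun h => by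
    have := congrArg Subtype.val h
    norm_num [s₀] at this
  have hs₀1 : s₀ ≠ 1 := fun h => by
    have := congrArg Subtype.val h
    norm_num [s₀] at this
  have hp₀ : c.neck (x₀, s₀) ∈ (c.body₁)ᶜ ∩ (c.body₀)ᶜ :=
    ⟨fun h => hs₀1 (c.eq_one_of_neck_mem h), fun h => hs₀0 (c.eq_zero_of_neck_mem h)⟩
  haveI : PathConnectedSpace P := by
    rw [pathConnectedSpace_iff_univ, ← c.compl_body₁_union_compl_body₀]
    exact h₁.union h₀ ⟨_, hp₀⟩
  haveI : PathConnectedSpace Q := by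
    rw [pathConnectedSpace_iff_univ, ← m.compl_south_union_compl_north]
    refine IsPathConnected.union ?_ ?_ ⟨c.toModel m (c.neck (x₀, s₀)),
      c.mapsTo_toModel_compl_body₁ m hp₀.1, c.mapsTo_toModel_compl_body₀ m hp₀.2⟩
    · exact isPathConnected_iff_pathConnectedSpace.mpr inferInstance
    · exact isPathConnected_iff_pathConnectedSpace.mpr inferInstance
  rcases k with _ | k
  · exact Literature.AlgebraicTopology.SingularHomology.singularHomology.isIso_map_zero_of_pathConnectedSpace R M _
  haveI : PathConnectedSpace ↥(c.body₁)ᶜ := isPathConnected_iff_pathConnectedSpace.mp h₁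
  haveI : PathConnectedSpace ↥(c.body₀)ᶜ := isPathConnected_iff_pathConnectedSpace.mp h₀
  haveI := c.isIso_singularHomology_map_restrict_toModel m R M k
  haveI : Mono (biprod.map
      (Literature.AlgebraicTopology.SingularHomology.singularHomology.map R M (Literature.AlgebraicTopology.SingularHomology.subsetRestrict (c.toModel m) (c.mapsTo_toModel_compl_body₁ m)) k)
      (Literature.AlgebraicTopology.SingularHomology.singularHomology.map R M (Literature.AlgebraicTopology.SingularHomology.subsetRestrict (c.toModel m) (c.mapsTo_toModel_compl_body₀ m)) k)) := by
    rcases k with _ | k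
    · set a := Literature.AlgebraicTopology.SingularHomology.singularHomology.map R M
        (Literature.AlgebraicTopology.SingularHomology.subsetRestrict (c.toModel m) (c.mapsTo_toModel_compl_body₁ m)) 0
      set b := Literature.AlgebraicTopology.SingularHomology.singularHomology.map R M
        (Literature.AlgebraicTopology.SingularHomology.subsetRestrict (c.toModel m) (c.mapsTo_toModel_compl_body₀ m)) 0
      haveI : IsIso a := Literature.AlgebraicTopology.SingularHomology.singularHomology.isIso_map_zero_of_pathConnectedSpace R M _
      haveI : IsIso b := Literature.AlgebraicTopology.SingularHomology.singularHomology.isIso_map_zero_of_pathConnectedSpace R M _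
      have hab : biprod.map a b = (biprod.mapIso (asIso a) (asIso b)).hom := by
        simp only [biprod.mapIso_hom, asIso_hom]
      rw [hab]
      infer_instance
    · exact ((biprod_isZero_iff _ _).mpr ⟨hz₁ _ (by omega), hz₀ _ (by omega)⟩).mono _
  exact isIso_singularHomology_map_succ_of_mayerVietoris R M (c.toModel m)
    (c.mapsTo_toModel_compl_body₁ m) (c.mapsTo_toModel_compl_body₀ m)
    c.interior_compl_body₁_union m.interior_compl_south_union k
    (hz₁ _ (by omega)) (hz₀ _ (by omega))
    (Literature.AlgebraicTopology.SingularHomology.isZero_singularHomology_of_contractibleSpace R M (X := ↥(({m.south}ᶜ : Set Q))) (by omega))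
    (Literature.AlgebraicTopology.SingularHomology.isZero_singularHomology_of_contractibleSpace R M (X := ↥(({m.north}ᶜ : Set Q))) (by omega))

end Compact

end SuspensionLikeCover

/-! ### §4 Sums of homotopy spheres -/

namespace ConnectedSumNeck

variable {n : ℕ} {S T : HomotopySphere n} {P : Type} [TopologicalSpace P]
  (d : ConnectedSumNeck n S.carrier T.carrier P)

/-- The punctured summand `N ∖ {i₂ 0}` is homeomorphic to the open piece `P ∖ body₁ = range jB`
of the connected sum. [cite: KervaireMilnorAnnals1963, §2 (p. 505)] -/
theorem nonempty_homeomorph_compl_body₁ :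
    Nonempty (↥(({d.i₂ 0}ᶜ : Set T.carrier)) ≃ₜ ↥((d.cover.body₁)ᶜ)) := by
  have hB : (d.cover.body₁)ᶜ = range d.jB := by rw [d.cover_body₁, compl_compl]
  exact ⟨d.isEmbedding_jB.toHomeomorph.trans (Homeomorph.setCongr hB.symm)⟩

/-- The punctured summand `M ∖ {i₁ 0}` is homeomorphic to the open piece `P ∖ body₀ = range jA`
of the connected sum. [cite: KervaireMilnorAnnals1963, §2 (p. 505)] -/
theorem nonempty_homeomorph_compl_body₀ :
    Nonempty (↥(({d.i₁ 0}ᶜ : Set S.carrier)) ≃ₜ ↥((d.cover.body₀)ᶜ)) := by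
  have hA : (d.cover.body₀)ᶜ = range d.jA := by rw [d.cover_body₀, compl_compl]
  exact ⟨d.isEmbedding_jA.toHomeomorph.trans (Homeomorph.setCongr hA.symm)⟩

/-- **The connected sum of two homotopy `n`-spheres, `n ≥ 2`, is an integral homology sphere**:
the pinch map `P → Sⁿ` of the gluing data (bodies to the poles, the cylinder `Sⁿ⁻¹ × [0, 1]`
onto the meridians: `SuspensionLikeCover.toModel` for the polar-coordinate model
`sphereSuspensionModel n`) induces isomorphisms `Hₖ(P; ℤ) ≅ Hₖ(Sⁿ; ℤ)` for all `k`
(Kosinski, *Differential Manifolds* (1993), VI §2, proof of Prop. 2.1: the Mayer–Vietoris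
sequence of the cover of `M₁ # M₂` by the punctured summands `Mᵢ ∖ {pt}`, which here are
acyclic — `PuncturedHomotopySphereHomology.lean` — and path connected —
`PuncturedHomotopySphere.lean`). [cite: Kosinski1993, Ch. VI §2 Prop. 2.1] [cite: KervaireMilnorAnnals1963, §2 (p. 505)] -/
theorem isIso_singularHomology_map_toModel [T2Space P] (hn : 2 ≤ n) (k : ℕ) :
    IsIso (Literature.AlgebraicTopology.SingularHomology.singularHomology.map ℤ ℤ (d.cover.toModel (Literature.AlgebraicTopology.Homotopy.sphereSuspensionModel n)) k) := by
  haveI : Nonempty (Fin n) := ⟨⟨0, by omega⟩⟩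
  haveI : Nonempty (sphere (0 : 𝔼 n) 1) :=
    (NormedSpace.sphere_nonempty.mpr zero_le_one).to_subtype
  obtain ⟨eB⟩ := d.nonempty_homeomorph_compl_body₁
  obtain ⟨eA⟩ := d.nonempty_homeomorph_compl_body₀
  haveI : PathConnectedSpace ↥(({d.i₂ 0}ᶜ : Set T.carrier)) :=
    isPathConnected_iff_pathConnectedSpace.mp (T.isPathConnected_compl_singleton hn (d.i₂ 0))
  haveI : PathConnectedSpace ↥(({d.i₁ 0}ᶜ : Set S.carrier)) :=
    isPathConnected_iff_pathConnectedSpace.mp (S.isPathConnected_compl_singleton hn (d.i₁ 0))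
  refine Literature.AlgebraicTopology.Homotopy.SuspensionLikeCover.isIso_singularHomology_map_toModel d.cover (Literature.AlgebraicTopology.Homotopy.sphereSuspensionModel n)
    ℤ ℤ ?_ ?_ ?_ ?_ ?_ ?_ k
  · have h := isPathConnected_range (continuous_subtype_val.comp eB.continuous)
    rwa [range_comp, eB.range_coe, image_univ, Subtype.range_coe] at h
  · have h := isPathConnected_range (continuous_subtype_val.comp eA.continuous)
    rwa [range_comp, eA.range_coe, image_univ, Subtype.range_coe] at h
  · intro k hk
    exact (T.isZero_singularHomology_compl_singleton hn (d.i₂ 0) hk).of_iso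
      (Literature.AlgebraicTopology.SingularHomology.singularHomology.isoOfHomotopyEquiv ℤ ℤ eB.toHomotopyEquiv k).symm
  · intro k hk
    exact (S.isZero_singularHomology_compl_singleton hn (d.i₁ 0) hk).of_iso
      (Literature.AlgebraicTopology.SingularHomology.singularHomology.isoOfHomotopyEquiv ℤ ℤ eA.toHomotopyEquiv k).symm
  · exact HomotopySphere.contractibleSpace_compl_singleton_unitSphere (n := n) _
  · exact HomotopySphere.contractibleSpace_compl_singleton_unitSphere (n := n) _

end ConnectedSumNeck

namespace HomotopySphere

variable {n : ℕ}

/-- **The connected sum of two homotopy `n`-spheres, `n ≥ 2`, has the integral homology of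
`Sⁿ`, via a map**: there is a continuous map `f : P → Sⁿ` (the pinch map of the gluing data)
inducing isomorphisms `Hₖ(P; ℤ) ≅ Hₖ(Sⁿ; ℤ)` for all `k` (Kosinski 1993, VI §2, Prop. 2.1,
Mayer–Vietoris; the homological half of Kervaire–Milnor's remark, *Groups of homotopy
spheres I* (1963), §2, p. 505). [cite: Kosinski1993, Ch. VI §2 Prop. 2.1] [cite: KervaireMilnorAnnals1963, §2 (p. 505)] -/
theorem exists_isIso_singularHomology_map_of_isConnectedSum (hn : 2 ≤ n) (S T : HomotopySphere n)
    (P : Type) [TopologicalSpace P] [T2Space P] [ChartedSpace (𝔼 n) P]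
    (hP : IsConnectedSum (𝓡 n) (𝓡 n) (𝓡 n) S.carrier T.carrier P) :
    ∃ f : C(P, 𝕊 n), ∀ k, IsIso (Literature.AlgebraicTopology.SingularHomology.singularHomology.map ℤ ℤ f k) := by
  obtain ⟨i₁, i₂, hi₁, hi₂, jA, jB, hjA, hAo, hjB, hBo, hU, hR⟩ := hP
  let d : ConnectedSumNeck n S.carrier T.carrier P :=
    { i₁ := i₁
      i₂ := i₂
      jA := jA
      jB := jB
      continuous_i₁ := hi₁.isEmbedding.continuous
      injective_i₁ := hi₁.isEmbedding.injective
      continuous_i₂ := hi₂.isEmbedding.continuous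
      injective_i₂ := hi₂.isEmbedding.injective
      isEmbedding_jA := hjA.isEmbedding
      isEmbedding_jB := hjB.isEmbedding
      isOpen_range_jA := hAo
      isOpen_range_jB := hBo
      union_range := hU
      rel := hR }
  exact ⟨d.cover.toModel (Literature.AlgebraicTopology.Homotopy.sphereSuspensionModel n), d.isIso_singularHomology_map_toModel hn⟩

/-- **The connected sum of two homotopy `n`-spheres is a homotopy sphere, `n ≥ 3`, by
Whitehead's theorem** — the printed architecture (Kosinski, *Differential Manifolds* (1993),
VI §2, Prop. 2.1: Mayer–Vietoris, van Kampen for `m ≥ 3`, and Whitehead; Kervaire–Milnor 1963,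
§2, p. 505, "it is clear"): `P` is simply connected (tree theorem
`HomotopySphere.simplyConnectedSpace_of_isConnectedSum`), the pinch map `P → Sⁿ` is a homology
isomorphism (`exists_isIso_singularHomology_map_of_isConnectedSum`), hence a homotopy equivalence
by Whitehead's theorem for closed manifolds (tree theorem
`exists_homotopyEquiv_of_isIso_map_of_closedManifold`, from the two named facts
`Literature.AlgebraicTopology.Homotopy.whitehead_exists_homotopyEquiv`, Hatcher 2002, Cor. 4.33, and
`Literature.AlgebraicTopology.Homotopy.exists_cwComplex_homotopyEquiv_of_compactSpace`, Hatcher 2002, Cor. A.12 — the hypotheses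
`hW`, `hCW`). [cite: Kosinski1993, Ch. VI §2 Prop. 2.1] [cite: KervaireMilnorAnnals1963, §2 (p. 505)] [cite: HatcherAT2002, Cor. 4.33 and Cor. A.12] -/
theorem nonempty_homotopyEquiv_sphere_of_isConnectedSum_of_whitehead
    (hW : Literature.AlgebraicTopology.Homotopy.whitehead_exists_homotopyEquiv.{0}) (hCW : Literature.AlgebraicTopology.Homotopy.exists_cwComplex_homotopyEquiv_of_compactSpace.{0})
    (h3 : 3 ≤ n) (S T : HomotopySphere n) (P : Type) [TopologicalSpace P] [T2Space P]
    [ChartedSpace (𝔼 n) P] [CompactSpace P]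
    (hP : IsConnectedSum (𝓡 n) (𝓡 n) (𝓡 n) S.carrier T.carrier P) : Nonempty (P ≃ₕ 𝕊 n) := by
  haveI := simplyConnectedSpace_of_isConnectedSum h3 S T P hP
  haveI : SimplyConnectedSpace (𝕊 n) := simplyConnectedSpace_euclideanSphere (by omega)
  obtain ⟨f, hf⟩ := exists_isIso_singularHomology_map_of_isConnectedSum (by omega) S T P hP
  obtain ⟨e, -⟩ := Literature.AlgebraicTopology.Homotopy.exists_homotopyEquiv_of_isIso_map_of_closedManifold (m := n) (n := n) hW hCW f hf
  exact ⟨e⟩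

/-- **The sum of two homotopy spheres is a homotopy sphere, in all dimensions, from Whitehead's
theorem (`n ≥ 3`) and the smooth Poincaré conjecture in dimensions `1, 2`.** Kervaire–Milnor's
statement (*Groups of homotopy spheres I* (1963), §2, p. 505; tree fact
`HomotopySphere.nonempty_homotopyEquiv_sphere_of_isConnectedSum`) follows from the named facts
`Literature.AlgebraicTopology.Homotopy.whitehead_exists_homotopyEquiv` (Hatcher 2002, Cor. 4.33) and
`Literature.AlgebraicTopology.Homotopy.exists_cwComplex_homotopyEquiv_of_compactSpace` (Hatcher 2002, Cor. A.12), used for `n ≥ 3`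
(`nonempty_homotopyEquiv_sphere_of_isConnectedSum_of_whitehead`), and from the smooth Poincaré
conjecture in dimensions `1` and `2` (hypothesis `h12`; classification of curves and surfaces),
used for `n = 1, 2` through the suspension argument of `HomotopySpheresSum.lean` with the disc
complements contractible by Palais' theorem (`HomotopySpheresSumProofs.lean`); `n = 0` is
proved there outright. [cite: KervaireMilnorAnnals1963, §2 (p. 505)] [cite: Kosinski1993, Ch. VI §2 Prop. 2.1] -/
theorem nonempty_homotopyEquiv_sphere_of_isConnectedSum_of_whitehead_of_spc
    (hW : Literature.AlgebraicTopology.Homotopy.whitehead_exists_homotopyEquiv.{0}) (hCW : Literature.AlgebraicTopology.Homotopy.exists_cwComplex_homotopyEquiv_of_compactSpace.{0})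
    (h12 : ∀ n : ℕ, n = 1 ∨ n = 2 → ∀ (M : Type) [TopologicalSpace M] [T2Space M]
      [SecondCountableTopology M], ContinuousMap.HomotopyEquiv.NonemptyDiffeomorphSphere M n) :
    nonempty_homotopyEquiv_sphere_of_isConnectedSum := by
  intro n S T P _ _ _ _ _ _ hP
  rcases Nat.lt_or_ge n 3 with hn | hn
  · -- `n ≤ 2`: the suspension argument, the disc complements being contractible
    have hK : ∀ (S : HomotopySphere n) {i : 𝔼 n → S.carrier},
        Manifold.IsSmoothEmbedding 𝓘(ℝ, 𝔼 n) (𝓡 n) ∞ i →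
          ContractibleSpace ↥((i '' ball (0 : 𝔼 n) 1)ᶜ) := by
      intro S i hi
      interval_cases n
      · exact S.contractibleSpace_compl_image_ball_zero i
      · exact contractibleSpace_compl_image_ball_of_nonemptyDiffeomorphSphere
          (h12 1 (Or.inl rfl)) S hi
      · exact contractibleSpace_compl_image_ball_of_nonemptyDiffeomorphSphere
          (h12 2 (Or.inr rfl)) S hi
    obtain ⟨i₁, i₂, hi₁, hi₂, jA, jB, hjA, hAo, hjB, hBo, hU, hR⟩ := hP
    let d : ConnectedSumNeck n S.carrier T.carrier P :=
      { i₁ := i₁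
        i₂ := i₂
        jA := jA
        jB := jB
        continuous_i₁ := hi₁.isEmbedding.continuous
        injective_i₁ := hi₁.isEmbedding.injective
        continuous_i₂ := hi₂.isEmbedding.continuous
        injective_i₂ := hi₂.isEmbedding.injective
        isEmbedding_jA := hjA.isEmbedding
        isEmbedding_jB := hjB.isEmbedding
        isOpen_range_jA := hAo
        isOpen_range_jB := hBo
        union_range := hU
        rel := hR }
    exact d.nonempty_homotopyEquiv_sphere (hK S hi₁) (hK T hi₂)
  · exact nonempty_homotopyEquiv_sphere_of_isConnectedSum_of_whitehead hW hCW hn S T P hP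

/-- The same, with the low-dimensional input taken from the tree fact
`Literature.Topology.FourManifolds.nonemptyDiffeomorphSphere_of_mem` (spc4.S32: the smooth Poincaré conjecture in
dimensions `1, 2, 3, 5, 6, 12, 56, 61`; dimensions `1, 2` used). So Kervaire–Milnor's "it is
clear that the sum of two homotopy `n`-spheres is a homotopy `n`-sphere" rests, in the tree, on
Hatcher's Cor. 4.33 (Whitehead), Cor. A.12 (CW type of compact manifolds) and spc4.S32
(classification of curves and surfaces), everything else being proved.
[cite: KervaireMilnorAnnals1963, §2 (p. 505)] [cite: Kosinski1993, Ch. VI §2 Prop. 2.1] -/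
theorem nonempty_homotopyEquiv_sphere_of_isConnectedSum_of_whitehead_of_facts
    (hW : Literature.AlgebraicTopology.Homotopy.whitehead_exists_homotopyEquiv.{0}) (hCW : Literature.AlgebraicTopology.Homotopy.exists_cwComplex_homotopyEquiv_of_compactSpace.{0})
    (h32 : FourManifolds.nonemptyDiffeomorphSphere_of_mem.{0}) :
    nonempty_homotopyEquiv_sphere_of_isConnectedSum :=
  nonempty_homotopyEquiv_sphere_of_isConnectedSum_of_whitehead_of_spc hW hCW fun n hn M _ _ _ =>
    h32 n (by rcases hn with rfl | rfl <;> simp) M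

end HomotopySphere

end Literature.Topology.FourManifolds
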